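import Mathlib
import Literature.Geometry.Lorentzian.LorentzianMetric
import Literature.Geometry.Lorentzian.ImmersionChartMetric
import Literature.Geometry.Lorentzian.DataEmbeddingChartMetric
import Literature.Geometry.Lorentzian.CoordChartLorentz
import Literature.Geometry.Lorentzian.ExtensionProofs
import Literature.Geometry.Lorentzian.KerrSchild
import Literature.Geometry.Lorentzian.BoundedGeometry

/-!
# Route PhotonSphereChannels · crux `TameCensorship` (stmt-FinalStateConjecture-17431) · line `Sketch`, wave 4 ·
# stub `stub_normalChart_exists`: a normalised chart at a point of a spacetime

Helper file (`--supports stmt-FinalStateConjecture-17431`) of line `Sketch` (lead c2, 2026-08-17), a brick of the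
initial-segment extension of the PANCAKE LAW (alternative route to clause (a) of K3). The tail form of the law reads a
visible incomplete null geodesic in TAME charts whose metric components are pinned to the Minkowski form `η`; on the
compact initial segment no tame charts are given, and one needs, at EVERY point `p` of the spacetime, some smooth
injective open immersion `Ψ : O → 𝓢` of an open `O ∋ 0` of `E4` with `Ψ 0 = p` whose transported metric
`Ψ^* g = ImmersionChart.metric …` is exactly `η` AT the point `0` (it is then pinned near `0` by continuity, another
stub). This is O'Neill 1983, Ch. 2, Lemma 24 (Lorentz normal form of a nondegenerate symmetric bilinear form of
index `1`) combined with Ch. 3, pp. 90–91 (the metric transported along a local diffeomorphism): with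
`ψ = chartAt E4 p`, the chart components `B(a, b) = g_p(dψ⁻¹ a, dψ⁻¹ b)` at `ψ p` form a symmetric bilinear form on
`E4`, positive on the orthogonal complement of its timelike vectors (O'Neill 5.26 transported through the injective
`dψ⁻¹`) and with the timelike vector `dψ (T p)` (`T` the orienting field), so `C0Extension.exists_frame` gives a
linear frame `P : E4 ≃L E4` with `B(P v, P w) = η(v, w)`; the chart is `Ψ z = ψ⁻¹(ψ p + P z)` on
`O = {z | ψ p + P z ∈ ψ.target}`: smooth (inverse chart after an affine map), with injective differentials
`dψ⁻¹ ∘ P`, injective and an open embedding (`ψ⁻¹` is a homeomorphism of the open target onto the open source), and at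
`0` its components are `B(P v, P w) = η(v, w)`.

References: B. O'Neill, *Semi-Riemannian Geometry with Applications to Relativity* (1983), Ch. 2, Lemma 24;
Ch. 3, pp. 90–91; Ch. 5, Lemma 26.
-/

set_option linter.dupNamespace false
set_option maxSynthPendingDepth 3

open Literature.Geometry.Lorentzian
open scoped Manifold ContDiff Topology
open Set

noncomputable section

namespace Summit.FinalStateConjecture.FinalStateConjecture.Theorems.PhotonSphereChannels.TameCensorshipUnwind

/-- The inverse of a chart of the maximal atlas composed with an affine map `z ↦ y₀ + P z` of `E4` is `C^∞` on the
preimage of the chart target. [folklore] -/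
private theorem tcNormalChart_contMDiffOn {𝓢 : Spacetime.{0} 4} {ψ : OpenPartialHomeomorph 𝓢.carrier E4}
    (hψ : ψ ∈ IsManifold.maximalAtlas (𝓡 4) ∞ 𝓢.carrier) (y₀ : E4) (P : E4 ≃L[ℝ] E4) :
    ContMDiffOn 𝓘(ℝ, E4) (𝓡 4) ∞ (fun z : E4 ↦ ψ.symm (y₀ + P z)) ((fun z : E4 ↦ y₀ + P z) ⁻¹' ψ.target) :=
  (contMDiffOn_symm_of_mem_maximalAtlas hψ).comp (contDiff_const.add P.contDiff).contMDiff.contMDiffOn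
    fun _ hz ↦ hz

/-- The same map restricted to an open subset `O` of the preimage of the chart target is `C^∞` (stated with the
regularity `∞ + 1 = ∞` asked by `PseudoRiemannianMetric.comap`). [folklore] -/
private theorem tcNormalChart_contMDiff {𝓢 : Spacetime.{0} 4} {ψ : OpenPartialHomeomorph 𝓢.carrier E4}
    (hψ : ψ ∈ IsManifold.maximalAtlas (𝓡 4) ∞ 𝓢.carrier) (y₀ : E4) (P : E4 ≃L[ℝ] E4)
    {O : TopologicalSpace.Opens E4} (hO : ∀ z ∈ O, y₀ + P z ∈ ψ.target) :
    ContMDiff 𝓘(ℝ, E4) (𝓡 4) (∞ + 1) (fun z : O ↦ ψ.symm (y₀ + P z)) := by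
  have h : ((∞ : ℕ∞ω) + 1) = ∞ := rfl
  rw [h]
  exact ((tcNormalChart_contMDiffOn hψ y₀ P).mono fun z hz ↦ hO z hz).comp_contMDiff contMDiff_subtype_val
    fun z ↦ z.2

/-- The differential of `z ↦ ψ⁻¹(y₀ + P z)` at a point of the preimage of the chart target:
`dψ⁻¹_{y₀ + P x} ∘ P`. [folklore] -/
private theorem tcNormalChart_mfderiv_ext {𝓢 : Spacetime.{0} 4} {ψ : OpenPartialHomeomorph 𝓢.carrier E4}
    (hψ : ψ ∈ IsManifold.maximalAtlas (𝓡 4) ∞ 𝓢.carrier) (y₀ : E4) (P : E4 ≃L[ℝ] E4) {x : E4}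
    (hx : y₀ + P x ∈ ψ.target) (a : E4) :
    mfderiv 𝓘(ℝ, E4) (𝓡 4) (fun z : E4 ↦ ψ.symm (y₀ + P z)) x a =
      mfderiv 𝓘(ℝ, E4) (𝓡 4) ψ.symm (y₀ + P x) (P a) := by
  have hψd : MDifferentiableAt 𝓘(ℝ, E4) (𝓡 4) ψ.symm (y₀ + P x) :=
    (CoordChart.mdifferentiable_chart hψ).mdifferentiableAt_symm hx
  have hA : HasMFDerivAt 𝓘(ℝ, E4) 𝓘(ℝ, E4) (fun z : E4 ↦ y₀ + P z) x (P : E4 →L[ℝ] E4) :=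
    (P.hasFDerivAt.const_add y₀).hasMFDerivAt
  have hcomp := (hψd.hasMFDerivAt.comp x hA).mfderiv
  change mfderiv 𝓘(ℝ, E4) (𝓡 4) (ψ.symm ∘ fun z : E4 ↦ y₀ + P z) x a = _
  rw [hcomp]
  rfl

/-- The differential of the restriction to `O` is that of the map of `E4`: `d(Ψ)_z a = dψ⁻¹_{y₀ + P z} (P a)`.
[folklore] -/
private theorem tcNormalChart_mfderiv {𝓢 : Spacetime.{0} 4} {ψ : OpenPartialHomeomorph 𝓢.carrier E4}
    (hψ : ψ ∈ IsManifold.maximalAtlas (𝓡 4) ∞ 𝓢.carrier) (y₀ : E4) (P : E4 ≃L[ℝ] E4)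
    {O : TopologicalSpace.Opens E4} (hO : ∀ z ∈ O, y₀ + P z ∈ ψ.target) (z : O) (a : E4) :
    mfderiv 𝓘(ℝ, E4) (𝓡 4) (fun z : O ↦ ψ.symm (y₀ + P z)) z a =
      mfderiv 𝓘(ℝ, E4) (𝓡 4) ψ.symm (y₀ + P z) (P a) := by
  have hsm : ContMDiffOn 𝓘(ℝ, E4) (𝓡 4) ∞ (fun z : E4 ↦ ψ.symm (y₀ + P z)) O :=
    (tcNormalChart_contMDiffOn hψ y₀ P).mono fun z hz ↦ hO z hz
  rw [← ImmersionChart.mfderiv_ext_eq (Φ := fun z : O ↦ ψ.symm (y₀ + P z))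
    (Φext := fun z : E4 ↦ ψ.symm (y₀ + P z)) (fun _ ↦ rfl) hsm z]
  exact tcNormalChart_mfderiv_ext hψ y₀ P (hO z z.2) a

/-- The differentials of `Ψ : O → 𝓢`, `Ψ z = ψ⁻¹(y₀ + P z)`, are injective. [folklore] -/
private theorem tcNormalChart_injective_mfderiv {𝓢 : Spacetime.{0} 4} {ψ : OpenPartialHomeomorph 𝓢.carrier E4}
    (hψ : ψ ∈ IsManifold.maximalAtlas (𝓡 4) ∞ 𝓢.carrier) (y₀ : E4) (P : E4 ≃L[ℝ] E4)
    {O : TopologicalSpace.Opens E4} (hO : ∀ z ∈ O, y₀ + P z ∈ ψ.target) :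
    ∀ z : O, Function.Injective (mfderiv 𝓘(ℝ, E4) (𝓡 4) (fun z : O ↦ ψ.symm (y₀ + P z)) z) := by
  intro z a b hab
  rw [tcNormalChart_mfderiv hψ y₀ P hO z a, tcNormalChart_mfderiv hψ y₀ P hO z b] at hab
  exact P.injective ((CoordChart.mdifferentiable_chart hψ).symm.mfderiv_injective (hO z z.2) hab)

/-- `Ψ : O → 𝓢`, `Ψ z = ψ⁻¹(y₀ + P z)`, is injective. [folklore] -/
private theorem tcNormalChart_injective {𝓢 : Spacetime.{0} 4} {ψ : OpenPartialHomeomorph 𝓢.carrier E4}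
    (y₀ : E4) (P : E4 ≃L[ℝ] E4) {O : TopologicalSpace.Opens E4} (hO : ∀ z ∈ O, y₀ + P z ∈ ψ.target) :
    Function.Injective (fun z : O ↦ ψ.symm (y₀ + P z)) := by
  intro z₁ z₂ h
  have h1 : y₀ + P z₁ = y₀ + P z₂ := ψ.symm.injOn (hO z₁ z₁.2) (hO z₂ z₂.2) h
  exact Subtype.ext (P.injective (add_left_cancel h1))

/-- `Ψ : O → 𝓢`, `Ψ z = ψ⁻¹(y₀ + P z)`, is an open embedding (`ψ⁻¹` is an open map on the open chart target).
[folklore] -/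
private theorem tcNormalChart_isOpenEmbedding {𝓢 : Spacetime.{0} 4} {ψ : OpenPartialHomeomorph 𝓢.carrier E4}
    (hψ : ψ ∈ IsManifold.maximalAtlas (𝓡 4) ∞ 𝓢.carrier) (y₀ : E4) (P : E4 ≃L[ℝ] E4)
    {O : TopologicalSpace.Opens E4} (hO : ∀ z ∈ O, y₀ + P z ∈ ψ.target) :
    Topology.IsOpenEmbedding (fun z : O ↦ ψ.symm (y₀ + P z)) := by
  refine .of_continuous_injective_isOpenMap (tcNormalChart_contMDiff hψ y₀ P hO).continuous
    (tcNormalChart_injective y₀ P hO) fun V hV ↦ ?_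
  have himage : (fun z : O ↦ ψ.symm (y₀ + P z)) '' V =
      ψ.symm '' ((fun z : E4 ↦ y₀ + P z) '' (Subtype.val '' V)) := by
    rw [Set.image_image, Set.image_image]
  rw [himage]
  refine ψ.isOpen_image_symm_of_subset_target ?_ ?_
  · exact (isOpenMap_add_left y₀).comp P.isOpenMap _ (O.isOpen.isOpenMap_subtype_val V hV)
  · rintro _ ⟨_, ⟨z, -, rfl⟩, rfl⟩
    exact hO _ z.2

/-- **Stub `stub_normalChart_exists` of line `Sketch` (wave 4) for the crux `PhotonSphereChannels.TameCensorship`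
(stmt-FinalStateConjecture-17431): a normalised chart at a point.** Every point `p` of a spacetime `𝓢` is the image
of `0` under a smooth injective open immersion `Ψ : O → 𝓢` of an open `O ∋ 0` of `E4` whose transported metric
`Ψ^* g` AT `0` is exactly the Minkowski form. With `ψ = chartAt E4 p`, the chart components
`B = pullbackBilin ψ.symm g.val (ψ p)`, `B(a, b) = g(dψ⁻¹ a, dψ⁻¹ b)`, are symmetric, positive on the orthogonal
complement of timelike vectors (O'Neill 5.26, `LorentzianMetric.pos_of_orthogonal`, through the injective `dψ⁻¹`) and
timelike on `dψ (T p)` (`d(ψ⁻¹) ∘ dψ = id`), so `C0Extension.exists_frame` (O'Neill Ch. 2, Lemma 24) gives a frame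
`P : E4 ≃L E4` with `B(P v, P w) = η(v, w)`; then `O = {z | ψ p + P z ∈ ψ.target}` and `Ψ z = ψ⁻¹(ψ p + P z)`
(smooth, `dΨ = dψ⁻¹ ∘ P` injective, injective, open embedding, `Ψ 0 = p`, components at `0` by
`ImmersionChart.metric_val`). [cite: ONeillSemiRiemannian1983, Ch. 2, Lemma 24; Ch. 3, pp. 90–91] -/
theorem stub_normalChart_exists :
    ∀ (𝓢 : Spacetime.{0} 4) (p : 𝓢.carrier), ∃ (O : TopologicalSpace.Opens E4) (h0 : (0 : E4) ∈ O)
    (Ψ : O → 𝓢.carrier) (hΨ : ContMDiff 𝓘(ℝ, E4) (𝓡 4) (∞ + 1) Ψ)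
    (hΨ' : ∀ u, Function.Injective (mfderiv 𝓘(ℝ, E4) (𝓡 4) Ψ u)),
    Function.Injective Ψ ∧ Topology.IsOpenEmbedding Ψ ∧ Ψ ⟨0, h0⟩ = p ∧
      ∀ v w : E4, (ImmersionChart.metric 𝓢.metric.toPseudoRiemannianMetric hΨ hΨ' rfl).val ⟨0, h0⟩ v w =
        Minkowski.bilin v w := by
  intro 𝓢 p
  -- the preferred chart at `p`
  set ψ := chartAt E4 p
  have hψ : ψ ∈ IsManifold.maximalAtlas (𝓡 4) ∞ 𝓢.carrier := IsManifold.chart_mem_maximalAtlas p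
  have hps : p ∈ ψ.source := mem_chart_source E4 p
  have hpt : ψ p ∈ ψ.target := mem_chart_target E4 p
  -- the metric components at `ψ p`
  set B : E4 →L[ℝ] E4 →L[ℝ] ℝ :=
    pullbackBilin (I := 𝓡 4) (I' := 𝓘(ℝ, E4)) ψ.symm 𝓢.metric.val (ψ p)
  have hBapp : ∀ a b : E4, B a b = 𝓢.metric.val (ψ.symm (ψ p))
      (mfderiv 𝓘(ℝ, E4) (𝓡 4) ψ.symm (ψ p) a) (mfderiv 𝓘(ℝ, E4) (𝓡 4) ψ.symm (ψ p) b) := fun a b ↦ rfl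
  have hBsymm : ∀ a b, B a b = B b a := fun a b ↦ by
    rw [hBapp, hBapp]
    exact 𝓢.metric.symm _ _ _
  have hLinj : Function.Injective (mfderiv 𝓘(ℝ, E4) (𝓡 4) ψ.symm (ψ p)) :=
    (mdifferentiable_chart (I := 𝓡 4) p).symm.mfderiv_injective hpt
  have hBpos : ∀ a b, B a a < 0 → B a b = 0 → b ≠ 0 → 0 < B b b := by
    intro a b ha hab hb
    rw [hBapp] at ha hab ⊢
    exact 𝓢.metric.pos_of_orthogonal _ _ _ ha hab fun hb0 ↦ hb (hLinj (hb0.trans (map_zero _).symm))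
  -- the timelike leg `dψ (T p)`
  have hLu : mfderiv 𝓘(ℝ, E4) (𝓡 4) ψ.symm (ψ p)
      (mfderiv (𝓡 4) 𝓘(ℝ, E4) ψ p (𝓢.timeOrientation.vectorField p)) =
        𝓢.timeOrientation.vectorField p := by
    have h := (mdifferentiable_chart (I := 𝓡 4) p).symm_comp_deriv hps
    exact congrArg (fun Lm : TangentSpace (𝓡 4) p →L[ℝ] TangentSpace (𝓡 4) p ↦
      Lm (𝓢.timeOrientation.vectorField p)) h
  have hu : B (mfderiv (𝓡 4) 𝓘(ℝ, E4) ψ p (𝓢.timeOrientation.vectorField p))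
      (mfderiv (𝓡 4) 𝓘(ℝ, E4) ψ p (𝓢.timeOrientation.vectorField p)) < 0 := by
    rw [hBapp, hLu, ψ.left_inv hps]
    exact 𝓢.timeOrientation.isTimelike p
  -- the Lorentz frame at `ψ p` (O'Neill Ch. 2, Lemma 24)
  obtain ⟨P, -, -, -, hPiso⟩ := C0Extension.exists_frame hBsymm hBpos hu
  -- the normalised chart
  have hAcont : Continuous fun z : E4 ↦ ψ p + P z := continuous_const.add P.continuous
  set O : TopologicalSpace.Opens E4 :=
    ⟨(fun z : E4 ↦ ψ p + P z) ⁻¹' ψ.target, ψ.open_target.preimage hAcont⟩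
  have hO : ∀ z ∈ O, ψ p + P z ∈ ψ.target := fun z hz ↦ hz
  have h0 : (0 : E4) ∈ O := by
    show ψ p + P 0 ∈ ψ.target
    rw [map_zero, add_zero]
    exact hpt
  have hdΨ := tcNormalChart_mfderiv hψ (ψ p) P hO
  refine ⟨O, h0, fun z ↦ ψ.symm (ψ p + P z), tcNormalChart_contMDiff hψ (ψ p) P hO,
    tcNormalChart_injective_mfderiv hψ (ψ p) P hO, tcNormalChart_injective (ψ p) P hO,
    tcNormalChart_isOpenEmbedding hψ (ψ p) P hO, ?_, fun v w ↦ ?_⟩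
  · show ψ.symm (ψ p + P 0) = p
    rw [map_zero, add_zero]
    exact ψ.left_inv hps
  · rw [ImmersionChart.metric_val, hdΨ, hdΨ, ← hPiso v w, hBapp]
    have key : ∀ y : E4, y = ψ p →
        𝓢.metric.val (ψ.symm y) (mfderiv 𝓘(ℝ, E4) (𝓡 4) ψ.symm y (P v))
          (mfderiv 𝓘(ℝ, E4) (𝓡 4) ψ.symm y (P w)) =
        𝓢.metric.val (ψ.symm (ψ p)) (mfderiv 𝓘(ℝ, E4) (𝓡 4) ψ.symm (ψ p) (P v))
          (mfderiv 𝓘(ℝ, E4) (𝓡 4) ψ.symm (ψ p) (P w)) := by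
      rintro y rfl
      rfl
    exact key _ (by rw [map_zero, add_zero])

end Summit.FinalStateConjecture.FinalStateConjecture.Theorems.PhotonSphereChannels.TameCensorshipUnwind

end
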